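import Mathlib.NumberTheory.LSeries.DirichletContinuation
import Mathlib.Analysis.SpecialFunctions.Pow.Real
import Literature.NumberTheory.LFunctions.QuadraticCharacterDivisorSumHarmonic
import HarnessLib

/-!
# Harmonic sums over EXCEPTIONAL primes (`χ(p) = 1`) in the presence of a Siegel zero of quality `η`
# (Tao–Teräväinen 2022, Proposition 3.5)

Topic `Literature/NumberTheory/LFunctions`. ONE NAMED FACT (D-0014), typed for cell ls-idea on the
OFFER of seat ls-idea-lens-8 gen 5 (sixth wave (6.6)(a): «named facts `taoTeravainen2022_prop35`
[(3.22)+(3.23)] … would let `SplitHarmonicMassConfined t C K` (p579100) be DISCHARGED BY CITE in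
η-currency instead of the 150–250-line (g) ⇒ (R1) derivation»; referee A batch 39: «(6.1) print
location ADOPTED (A-I8-5 (R1) ≡ TT21 Prop. 3.5 (3.22)–(3.23) ≡ MM23 L.4.1/L.2.2)»). Nothing here
asserts that a Siegel zero exists: the statement is an implication whose antecedent
(`L(1 − 1/(η log q), χ) = 0`, `η ≥ 10`) is expected to be void. «The programme SEARCHES and TYPES; no
claim about Landau–Siegel zeros, Theorems 1–2 of arXiv:2211.02515 or a repaired Margin232 until a
kernel theorem says so.»

## What the source prints (held text `paper:arxiv-2109.06291-gx19813020`, p0002 and p0016, read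
2026-08-27)

Definition 1.4 (p. 2): «A Siegel zero `β` is a real number associated to a primitive quadratic
Dirichlet character `χ` of conductor `q_χ` such that `L(β, χ) = 0` and `β = 1 − 1/(η log q_χ)` for some
`η ≥ 10` (which we call the quality of the zero).» Exceptional primes `p*`: the primes with
`χ(p*) = 1` (footnote 5, p. 16: «these results only claim to control the set where `χ(p*) = 1`»).
**Proposition 3.5** (p. 16): «Let `ε > 0`. Then for any `x ≥ q_χ^{(1+ε)/2}`, one has
`Σ_{q_χ^{(1+ε)/2} < p* ≤ x} 1/p* ≪_ε (log_{q_χ} x)/η` (3.22) and for any natural number `m ≥ 2`, we have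
`Σ_{q_χ^{(1+ε)/(2m)} < p* ≤ q_χ^{(1+ε)/(2(m−1))}} 1/p* ≪_ε m/η^{1/m}` (3.23).» Proof: from
[MV I, Ex. 11.2.1.3(g)] (tree: `montgomeryVaughan2007_ex11_2_1_3g`), Siegel's theorem (so the
implied constant is INEFFECTIVE in `ε`), `L′/L(1,χ) ≍ η log q_χ` [MV I Thm 11.4], non-negativity and
multiplicativity of `1 ∗ χ`, `m`-fold products of exceptional primes. Re-proved as Matomäki–Merikoski
2023, Lemma 4.1 («essentially [TT]»).

## Lean rendering
* the quality hypothesis: `η ≥ 10` and `χ.LFunction (1 − 1/(η · log q)) = 0` (real point cast to ℂ);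
* `p*` sums: `p` prime with `χ(p) = 1`, over `Finset.Ioc`-type integer ranges `⌊a⌋₊ < p ≤ ⌊b⌋₊`
  (`a < p ⟺ ⌊a⌋₊ < p` and `p ≤ b ⟺ p ≤ ⌊b⌋₊` for natural `p`, `a, b ≥ 0`);
* «`≪_ε`» ⟶ `∀ ε > 0, ∃ C, …` (one constant for both displays);
* `log_{q} x = log x / log q`.

## References
* [TaoTeravainen2022SiegelZero] T. Tao, J. Teräväinen, J. London Math. Soc. (2) 106 (2022) 3317–3378 =
  arXiv:2109.06291, Definition 1.4 (p. 2), Proposition 3.5 (3.22)–(3.23) (p. 16).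
  [held: paper:arxiv-2109.06291-gx19813020 p0002, p0016–p0017]
* [MatomakiMerikoski2023] K. Matomäki, J. Merikoski, IMRN 2023 = arXiv:2112.11412, Lemma 4.1 / 2.2
  (re-proof and packaging).
-/

noncomputable section

namespace Literature.NumberTheory.LFunctions

/-- The harmonic sum over EXCEPTIONAL primes `p` (`χ(p) = 1`) with `a < p ≤ b`:
`Σ_{a < p ≤ b, p prime, χ(p) = 1} 1/p`. A DEFINITION (Tao–Teräväinen's `Σ 1/p*` over a range).
[cite: TaoTeravainen2022SiegelZero, Proposition 3.5 (the sums in (3.22)–(3.23))] -/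
def exceptionalPrimeHarmonicSum {q : ℕ} (χ : DirichletCharacter ℂ q) (a b : ℝ) : ℝ :=
  ∑ p ∈ (Finset.Ioc ⌊a⌋₊ ⌊b⌋₊).filter (fun p : ℕ => p.Prime ∧ χ ((p : ℕ) : ZMod q) = 1),
    1 / (p : ℝ)

/-- **Tao–Teräväinen 2022, Proposition 3.5.** For every `ε > 0` there is `C = C(ε)` such that for
every primitive quadratic `χ` of conductor `q` having a Siegel zero of QUALITY `η ≥ 10` — i.e.
`L(1 − 1/(η log q), χ) = 0` (Definition 1.4) — one has
(3.22) `Σ_{q^{(1+ε)/2} < p* ≤ x} 1/p* ≤ C·(log x/log q)/η` for every `x ≥ q^{(1+ε)/2}`, and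
(3.23) `Σ_{q^{(1+ε)/(2m)} < p* ≤ q^{(1+ε)/(2(m−1))}} 1/p* ≤ C·m/η^{1/m}` for every natural `m ≥ 2`,
`p*` ranging over primes with `χ(p*) = 1`. The implied constant is ineffective (Siegel's theorem is used
in the printed proof). NAMED FACT, not proved here; users take `(h : taoTeravainen2022_proposition35)`.
[cite: TaoTeravainen2022SiegelZero, Proposition 3.5 (3.22)–(3.23)] -/
def taoTeravainen2022_proposition35 : Prop :=
  ∀ ε : ℝ, 0 < ε → ∃ C : ℝ, ∀ (q : ℕ) [NeZero q] (χ : DirichletCharacter ℂ q), χ ≠ 1 →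
    χ.IsPrimitive → MulChar.IsQuadratic χ → ∀ η : ℝ, 10 ≤ η →
      χ.LFunction ((1 - 1 / (η * Real.log q) : ℝ) : ℂ) = 0 →
        (∀ x : ℝ, (q : ℝ) ^ ((1 + ε) / 2) ≤ x →
          exceptionalPrimeHarmonicSum χ ((q : ℝ) ^ ((1 + ε) / 2)) x ≤
            C * (Real.log x / Real.log q) / η) ∧
        (∀ m : ℕ, 2 ≤ m →
          exceptionalPrimeHarmonicSum χ ((q : ℝ) ^ ((1 + ε) / (2 * m)))
              ((q : ℝ) ^ ((1 + ε) / (2 * (m - 1 : ℝ)))) ≤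
            C * m / η ^ (1 / (m : ℝ)))

/-!
## Appendix (2026-08-27, cell ls-idea, lens-8 sixth wave (6.6)(a)/(b)): the `z`-rough form —
Matomäki–Merikoski 2023, Lemma 2.2

Held text `paper:arxiv-2112.11412` p0006:L102–L113 (read 2026-08-27): «**Lemma 2.2.** Let `χ` be a
primitive quadratic character modulo `q ≥ 2`. Assume that `L(s,χ)` has a real zero `β₀` such that
`β₀ = 1 − 1/(η log q)` for some `η ≥ 10`. Let `z = q^v` for some `v ∈ ℝ₊`. Then for any `Y > z`
`Σ_{z ≤ m ≤ Y, (m, P(z)) = 1} λ(m)/m ≪ (1/(v² η^{v/2}) + (v/η)·(log Y/log z) + 1/z)·(log Y/log z)²`»,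
where (§2, p0006:L39, L61) `λ := 1 ∗ χ` and `P(w) = Π_{p < w} p`; the implied constant is absolute.
Proved in the paper's §4 from its Lemma 4.1 (= Tao–Teräväinen Prop. 3.5 above, «essentially [TT]»).
Typed as a NAMED FACT on the OFFER of seat ls-idea-lens-8 gen 5 ((6.6)(a): «`matomakiMerikoski2023_lemma22`
[arXiv:2112.11412 Lemma 2.2, all `v > 0`]»), so that the Summits-side hypothesis shape
`PrimeLevelFamEdgeIdeaDeltas.SplitHarmonicMassConfined` can be discharged BY CITE in `η`-currency.
`λ(m) = Σ_{d ∣ m} χ(d)` is the tree's real `rDivisorSum χ m` (`QuadraticCharacterDivisorSumHarmonic`).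
-/

/-- The `z`-ROUGH harmonic sum of `λ = 1 ∗ χ` on `[z, Y]`: `Σ_{z ≤ m ≤ Y, (m, P(z)) = 1} λ(m)/m` with
`P(z) = Π_{p < z} p` — so `(m, P(z)) = 1` iff every prime factor of `m` is `≥ z` — and
`λ(m) = Σ_{d ∣ m} χ(d)` rendered as the real `rDivisorSum χ m`; `m` ranges over the naturals with
`⌈z⌉ ≤ m ≤ ⌊Y⌋`. A DEFINITION (the left side of Matomäki–Merikoski's Lemma 2.2).
[cite: MatomakiMerikoski2023, Lemma 2.2 (left side); §2 (λ := 1 ∗ χ, P(w) := Π_{p<w} p)] -/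
def roughLambdaHarmonicSum {q : ℕ} (χ : DirichletCharacter ℂ q) (z Y : ℝ) : ℝ :=
  ∑ m ∈ (Finset.Icc ⌈z⌉₊ ⌊Y⌋₊).filter (fun m : ℕ => ∀ p ∈ m.primeFactors, z ≤ (p : ℝ)),
    rDivisorSum χ m / (m : ℝ)

/-- **Matomäki–Merikoski 2023, Lemma 2.2.** There is an absolute `C` such that for every primitive
quadratic `χ` modulo `q ≥ 2` having a real zero `β₀ = 1 − 1/(η log q)` of quality `η ≥ 10`
(`L(1 − 1/(η log q), χ) = 0`), every `v > 0` (`z := q^v`) and every `Y > z`: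
`Σ_{z ≤ m ≤ Y, (m,P(z))=1} λ(m)/m ≤ C·(1/(v²·η^{v/2}) + (v/η)·(log Y/log z) + 1/z)·(log Y/log z)²`.
The hypothesis `χ ≠ 1` is redundant (primitive, `q ≥ 2`) and kept only for uniformity with
`taoTeravainen2022_proposition35`. NAMED FACT, not proved here (the paper derives it in §4 from
Lemma 4.1 ≡ Tao–Teräväinen Prop. 3.5, with Siegel's theorem inside, so `C` is ineffective as printed);
users take `(h : matomakiMerikoski2023_lemma22)`. Nothing here asserts that such a zero exists.
[cite: MatomakiMerikoski2023, Lemma 2.2] -/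
def matomakiMerikoski2023_lemma22 : Prop :=
  ∃ C : ℝ, ∀ (q : ℕ) [NeZero q] (χ : DirichletCharacter ℂ q), 2 ≤ q → χ ≠ 1 →
    χ.IsPrimitive → MulChar.IsQuadratic χ → ∀ η : ℝ, 10 ≤ η →
      χ.LFunction ((1 - 1 / (η * Real.log q) : ℝ) : ℂ) = 0 →
        ∀ v : ℝ, 0 < v → ∀ Y : ℝ, (q : ℝ) ^ v < Y →
          roughLambdaHarmonicSum χ ((q : ℝ) ^ v) Y ≤
            C * (1 / (v ^ 2 * η ^ (v / 2)) + v / η * (Real.log Y / Real.log ((q : ℝ) ^ v)) +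
                1 / (q : ℝ) ^ v) *
              (Real.log Y / Real.log ((q : ℝ) ^ v)) ^ 2

/-!
## Appendix 2 (2026-08-28, cell ls-idea, lens-8 sixth wave (6.6)(c)): the logarithmic form —
Heath-Brown 1983, Lemma 3, as quoted by Tao–Teräväinen (3.20)

Held text `paper:arxiv-2109.06291-gx19813020` p0015:L51–L53 (read 2026-08-28), §3.3 «Elementary
consequences of a Siegel zero»: «Recall from Section 2 that we use `p*` to denote primes that are
exceptional in the sense that `χ(p*) ≠ −1`. It is a well known phenomenon that exceptional primes
become rare at scales comparable in log-scale to `q`. For instance, in [11, Lemma 3] it was shown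
that⁵ `Σ_{p* ≤ q_χ^{500}} (log p*)/p* ≪ log q_χ/√(log η)` (3.20)», with footnote 5: «Strictly speaking,
these results only claim to control the set where `χ(p*) = 1`»; [11] = D. R. Heath-Brown, *Prime twins
and Siegel zeros*, PLMS (3) 47 (1983) 193–224; `η` = the quality of the Siegel zero
(`β = 1 − 1/(η log q_χ)`, `η ≥ 10`, Definition 1.4). The original [11] is NOT held (acquisition
`acq-00505`, cite-only); the fact is typed in Tao–Teräväinen's normalisation exactly as quoted, for the
primes with `χ(p) = 1` (footnote 5), and carries a `TODO(audit)` for Heath-Brown's own hypothesis on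
the real zero. Consumer: the Summits-side shape `PrimeLevelFamEdgeIdeaDeltas.SplitLogMassSmall ε D₀`
(annex A-I8-5 consequence (i) «`Σ_{split p ≤ D} log p/p = o(log D)`»), discharged BY CITE from this fact
and the tree's Hecke theorem (`exists_quality_of_norm_lOne_le`).
-/

/-- The LOGARITHMIC harmonic sum over exceptional primes `p ≤ N` (`χ(p) = 1`):
`Σ_{p ≤ N, p prime, χ(p) = 1} (log p)/p`, `p` over the naturals `1 ≤ p ≤ N`. A DEFINITION (the left
side of (3.20)). [cite: TaoTeravainen2022SiegelZero, §3.3 (3.20) (left side)] -/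
def exceptionalPrimeLogSum {q : ℕ} (χ : DirichletCharacter ℂ q) (N : ℕ) : ℝ :=
  ∑ p ∈ (Finset.Icc 1 N).filter (fun p : ℕ => p.Prime ∧ χ ((p : ℕ) : ZMod q) = 1),
    Real.log (p : ℝ) / (p : ℝ)

/-- **Heath-Brown 1983, Lemma 3** (as quoted in Tao–Teräväinen 2022, (3.20)): there is an absolute
`C` such that for every primitive quadratic `χ` of conductor `q` having a Siegel zero of quality
`η ≥ 10` — `L(1 − 1/(η log q), χ) = 0` — one has
`Σ_{p ≤ q^{500}, χ(p) = 1} (log p)/p ≤ C · log q / √(log η)`.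
NAMED FACT, not proved here; users take `(h : heathBrown1983_lemma3)`. The hypothesis `χ ≠ 1` is
redundant for primitive `χ` of conductor `≥ 2` and kept for uniformity with
`taoTeravainen2022_proposition35`. Nothing here asserts that such a zero exists.
-- TODO(audit, acq-00505): Heath-Brown's original hypothesis on the real zero and his range/normalisation
-- (the statement above is Tao–Teräväinen's rendering with their Definition 1.4 of the quality `η`).
[cite: HeathBrown1983PrimeTwins, Lemma 3 (as quoted in TaoTeravainen2022SiegelZero (3.20), p. 15)] -/
def heathBrown1983_lemma3 : Prop :=
  ∃ C : ℝ, ∀ (q : ℕ) [NeZero q] (χ : DirichletCharacter ℂ q), χ ≠ 1 →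
    χ.IsPrimitive → MulChar.IsQuadratic χ → ∀ η : ℝ, 10 ≤ η →
      χ.LFunction ((1 - 1 / (η * Real.log q) : ℝ) : ℂ) = 0 →
        exceptionalPrimeLogSum χ (q ^ 500) ≤ C * Real.log q / Real.sqrt (Real.log η)

/-- Bookkeeping (proved): the logarithmic exceptional-prime sum is monotone in the range (non-negative
terms). [cite: TaoTeravainen2022SiegelZero, §3.3 (3.20)] -/
theorem exceptionalPrimeLogSum_mono {q : ℕ} (χ : DirichletCharacter ℂ q) {N N' : ℕ} (h : N ≤ N') :
    exceptionalPrimeLogSum χ N ≤ exceptionalPrimeLogSum χ N' := by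
  unfold exceptionalPrimeLogSum
  apply Finset.sum_le_sum_of_subset_of_nonneg
  · intro p hp
    simp only [Finset.mem_filter, Finset.mem_Icc] at hp ⊢
    exact ⟨⟨hp.1.1, hp.1.2.trans h⟩, hp.2⟩
  · intro p hp _
    simp only [Finset.mem_filter, Finset.mem_Icc] at hp
    have hp1 : (1 : ℝ) ≤ p := by exact_mod_cast hp.1.1
    exact div_nonneg (Real.log_nonneg hp1) (by linarith)

end Literature.NumberTheory.LFunctions
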